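import Literature.Computation.Certificates.GramSOSList
import Literature.Computation.Certificates.PsdRoundedTwin
import Literature.Computation.Certificates.PackedGramRowsOfLists

/-!
# Rounded-twin PSD lane: entry points for list Gram blocks (`SOS.GramL`)

Compute-infrastructure glue (certnum L4; gridfusion #50 «G2.a-K2A-alg-deg4», 2026-08-27). The SOS
assembly lemmas on list carriers (`GramSOSList.lean`: `GramL.nonneg_of_quadL`, `nonneg_of_chunksL`,
`nonneg_of_slicesL`, …) consume, per Gram block `g : GramL`, the form-agnostic hypothesis
`g.toGramSOS.QuadNonneg R` — `∀ y, 0 ≤ Σ_a Σ_b y_a · y_b · Q_ab` for `Q = matrixOfRows g.s g.s g.Q`.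
The rounded-twin lane (`PsdRoundedTwin.lean`: certify a low-height integer twin `M` of `S·Q − s·1` and
pay the rounding with the margin `n·e ≤ s` [cite: Rump1999VerifiedLargeSystems, §4 Algorithm 4.1
step 7]) concludes `∀ y, 0 ≤ Σ_i Σ_j y_i · Q_ij · y_j` for the same matrix. This file states the
(trivial) rearrangement once and the composed entry points, so that an emitted block proof is ONE term:

* `GramL.quadNonneg_of_quadForm` — the rearrangement `y_i · Q_ij · y_j = y_i · y_j · Q_ij`;
* `GramL.quadNonneg_of_roundedTwin` / `…_ranges` — twin certificate `PSD.IsGramCertZ` of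
  `matrixOfRows g.s g.s Mrows` (ANY integer lane) + closeness (`closeCheckN`, or `closeRangeN` per
  row range) + margin ⇒ `QuadNonneg`;
* `GramL.quadNonneg_of_packedTwin` / `…_ranges` / `…_split` — the same with the twin certified by the
  packed rows lane on list data (`PSD.Packed.checkRows` of the in-kernel packing + `packable`,
  `PackedGramRowsOfLists.lean`; `_split` = head + row ranges of the packed check as well).

Typical sizes (gridfusion 2026-08-27): the deg-4 WSCC9 V̇ block (s = 119, 167-bit denominators):
twin `S = 2^22`, `s = 238`, 53-bit `M`, 27-bit factor digits, whole block 80 s on the farm; the #50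
two-area Kundur block (s = 189, 163-bit denominators, λ_min ≈ 7.8·10⁻⁶): `S = 2^27`, `s = 348`,
60-bit `M`, 30-bit digits. WHAT THIS FILE DOES NOT CERTIFY: that a twin exists (a nearly singular `Q`
has none — use an exact lane: `GramL.quadNonneg_of_gramCertZ`); anything beyond `QuadNonneg` of the
block (no eigenvalue bound is exported); the identity/residual side of the SOS certificate.
-/

namespace Literature.Computation.Certificates

namespace SOS

namespace GramL

variable {R : Type*} [Field R] [LinearOrder R] [IsStrictOrderedRing R]

/-- **Rearrangement**: a nonnegative quadratic form `Σ_i Σ_j y_i · Q_ij · y_j ≥ 0` of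
`Q = matrixOfRows g.s g.s g.Q` (the conclusion shape of the twin / perturbation lemmas) IS the
`QuadNonneg` hypothesis of the list block's `GramSOS` view (the Gram-matrix method's positive
semidefiniteness condition, written as a quadratic form). [cite: BlekhermanParriloThomas2012, Thm 3.39] -/
theorem quadNonneg_of_quadForm (g : GramL)
    (h : ∀ y : Fin g.s → R, 0 ≤ ∑ i, ∑ j, y i * ((matrixOfRows g.s g.s g.Q i j : ℚ) : R) * y j) :
    g.toGramSOS.QuadNonneg R := by
  intro y
  refine (h y).trans_eq (Finset.sum_congr rfl fun i _ => Finset.sum_congr rfl fun j _ => ?_)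
  exact mul_right_comm _ _ _

/-- **Twin lane, one closeness check**: an integer Gram certificate of the shifted twin rows `Mrows`
(any lane), `closeCheckN g.s S s e g.Q Mrows` and the margin `g.s · e ≤ s` give `QuadNonneg` of the
block. [cite: Rump1999VerifiedLargeSystems, §4 Algorithm 4.1 step 7] -/
theorem quadNonneg_of_roundedTwin (g : GramL) {m S s e : ℕ} {Mrows : List (List ℤ)}
    {d : Fin m → ℕ} {B : Matrix (Fin m) (Fin g.s) ℤ}
    (hM : PSD.IsGramCertZ (matrixOfRows g.s g.s Mrows) d B)
    (hclose : PSD.closeCheckN g.s S s e g.Q Mrows = true) (hmargin : g.s * e ≤ s) :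
    g.toGramSOS.QuadNonneg R :=
  g.quadNonneg_of_quadForm fun y => PSD.quadForm_nonneg_of_roundedTwin hM hclose hmargin y

/-- **Twin lane, chunked closeness**: as `quadNonneg_of_roundedTwin` with the closeness checked in
`mch` row ranges of `k` rows (`closeRangeN … (c·k) k`, one `decide +kernel` each, possibly in separate
files) covering the block (`g.s ≤ mch · k`). [cite: Rump1999VerifiedLargeSystems, §4 Algorithm 4.1 step 7] -/
theorem quadNonneg_of_roundedTwin_ranges (g : GramL) {m S s e k mch : ℕ} {Mrows : List (List ℤ)}
    {d : Fin m → ℕ} {B : Matrix (Fin m) (Fin g.s) ℤ}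
    (hM : PSD.IsGramCertZ (matrixOfRows g.s g.s Mrows) d B) (hS : 0 < S)
    (hranges : ∀ c : Fin mch, PSD.closeRangeN g.s S s e (c.val * k) k g.Q Mrows = true)
    (hcover : g.s ≤ mch * k) (hmargin : g.s * e ≤ s) :
    g.toGramSOS.QuadNonneg R :=
  g.quadNonneg_of_quadForm fun y =>
    PSD.quadForm_nonneg_of_roundedTwin_ranges hM hS hranges hcover hmargin y

/-- **Twin lane with the packed rows certificate (one piece)**: the twin rows `Mrows` certified by
`PSD.Packed.checkRows` on their in-kernel packing (+ `packable`), one closeness check, margin.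
[cite: Rump1999VerifiedLargeSystems, §4 Algorithm 4.1 step 7] -/
theorem quadNonneg_of_packedTwin (g : GramL) {w den v x O S s e : ℕ} {Mrows : List (List ℤ)}
    {ds Crows : List ℕ}
    (hcheck : PSD.Packed.checkRows g.s w den v x O (Mrows.map (PSD.Packed.packRow w)) ds Crows = true)
    (hp : PSD.Packed.packable g.s w Mrows = true)
    (hclose : PSD.closeCheckN g.s S s e g.Q Mrows = true) (hmargin : g.s * e ≤ s) :
    g.toGramSOS.QuadNonneg R :=
  g.quadNonneg_of_roundedTwin (PSD.Packed.isGramCertZ_matrixOfRows_of_checkRows hcheck hp)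
    hclose hmargin

/-- **Twin lane with the packed rows certificate, chunked closeness** — the emitters' default shape
for blocks of size ≳ 100. [cite: Rump1999VerifiedLargeSystems, §4 Algorithm 4.1 step 7] -/
theorem quadNonneg_of_packedTwin_ranges (g : GramL) {w den v x O S s e k mch : ℕ}
    {Mrows : List (List ℤ)} {ds Crows : List ℕ}
    (hcheck : PSD.Packed.checkRows g.s w den v x O (Mrows.map (PSD.Packed.packRow w)) ds Crows = true)
    (hp : PSD.Packed.packable g.s w Mrows = true) (hS : 0 < S)
    (hranges : ∀ c : Fin mch, PSD.closeRangeN g.s S s e (c.val * k) k g.Q Mrows = true)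
    (hcover : g.s ≤ mch * k) (hmargin : g.s * e ≤ s) :
    g.toGramSOS.QuadNonneg R :=
  g.quadNonneg_of_roundedTwin_ranges (PSD.Packed.isGramCertZ_matrixOfRows_of_checkRows hcheck hp)
    hS hranges hcover hmargin

/-- **Twin lane, everything split**: the packed rows certificate of the twin as head + row ranges
(`PSD.Packed.checkRowsHead`, `RangesOK`, covering `g.s` rows) and the closeness in row ranges — every
kernel fact is one `decide +kernel` that can live in its own file.
[cite: Rump1999VerifiedLargeSystems, §4 Algorithm 4.1 step 7] -/
theorem quadNonneg_of_packedTwin_split (g : GramL) {w den v x O S s e k mch : ℕ}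
    {Mrows : List (List ℤ)} {ds Crows cnts : List ℕ}
    (hhead : PSD.Packed.checkRowsHead g.s w den v x O (Mrows.map (PSD.Packed.packRow w)) ds Crows
      = true)
    (hrows : PSD.Packed.RangesOK w v x O (Mrows.map (PSD.Packed.packRow w)) ds Crows 0 cnts)
    (hcnts : g.s ≤ cnts.sum) (hp : PSD.Packed.packable g.s w Mrows = true) (hS : 0 < S)
    (hranges : ∀ c : Fin mch, PSD.closeRangeN g.s S s e (c.val * k) k g.Q Mrows = true)
    (hcover : g.s ≤ mch * k) (hmargin : g.s * e ≤ s) :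
    g.toGramSOS.QuadNonneg R :=
  have hM : PSD.IsGramCertZ (matrixOfRows g.s g.s Mrows) (PSD.Packed.weights ds)
      (PSD.Packed.factorRows v O ds Crows g.s) := by
    rw [← PSD.Packed.intMatrixRows_map_packRow hp]
    exact PSD.Packed.isGramCertZ_of_checkRowsRanges hhead hrows hcnts
  g.quadNonneg_of_roundedTwin_ranges hM hS hranges hcover hmargin

end GramL

/-! ### Kernel-checked examples: the `2 × 2` block of `PsdRoundedTwin.lean` as a `GramL`
(basis `[x₀, x₁]`, `Q = [[2 + 3⁻⁴⁰, −1], [−1, 2 − 3⁻⁴⁰]]`, twin `M = [[6, −4], [−4, 6]]`, `S = 4`,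
`s = 2`, `e = 1`) -/

/-- Test: `QuadNonneg` over `ℝ` by the twin, its integer certificate decided directly, closeness in
two one-row ranges. -/
example : (GramL.toGramSOS ⟨[[1, 0], [0, 1]],
      [[(2 : ℚ) + 1 / 3 ^ 40, -1], [-1, (2 : ℚ) - 1 / 3 ^ 40]], [], []⟩).QuadNonneg ℝ :=
  GramL.quadNonneg_of_roundedTwin_ranges _ (S := 4) (s := 2) (e := 1) (k := 1) (mch := 2)
    (Mrows := [[6, -4], [-4, 6]]) (d := ![4, 2]) (B := !![1, -1; 0, 1]) (by decide +kernel)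
    (by decide) (by intro c; fin_cases c <;> decide +kernel) (by decide) (by decide)

/-- Test: the same through the packed rows certificate of the twin, packed in the kernel (`w = 4`,
unit weights `d = [1, 1]`, factor `B = [[2, −2], [0, 1]]` — residual `M − BᵀB = [[2, 0], [0, 1]]` —
given by its columns, digits base `2^3` with offset `O = 3`, bound `x = 8`), one closeness check. -/
example : (GramL.toGramSOS ⟨[[1, 0], [0, 1]],
      [[(2 : ℚ) + 1 / 3 ^ 40, -1], [-1, (2 : ℚ) - 1 / 3 ^ 40]], [], []⟩).QuadNonneg ℝ :=
  GramL.quadNonneg_of_packedTwin _ (w := 4) (den := 1) (v := 3) (x := 8) (O := 3) (S := 4)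
    (s := 2) (e := 1) (Mrows := [[6, -4], [-4, 6]]) (ds := [1, 1])
    (Crows := [[2, 0], [-2, 1]].map (PSD.Packed.packCol 3 3))
    (by decide +kernel) (by decide +kernel) (by decide +kernel) (by decide)

end SOS

end Literature.Computation.Certificates
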